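import Summits.HodgeConjecture.HodgeConjecture.Theorems.F0P6bWDockWBlockLaw   -- ★ previous part of the same Lines workfile (size-lint split; same namespace `Summit.HodgeConjecture.HodgeConjecture.Cruxes.HLiu418.F0P6bWDock`)
import HarnessLib

/-!
# `F0P6bWDockSeams` — ★ RE-HOME of `Lines/F0_P6b_WDock.lean` (tree ED. 4 7d61e77295a90030), PART 3 of 4 — §4 the (D-R) seam (`rosati_baseChange`, `wDockPackage_of_baseChange*`) then §6.6∕§6.7 (`WBlockLawED4b`, `WBlockLawED4c`); §4 is placed AFTER `WBlockLaw` here (it was before it in the workfile) — the two blocks share no names, so every declaration and proof is byte-identical and only the file order of two independent top-level blocks differs.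

See PART 1 `Theorems/F0P6bWDockPackage.lean` for the full re-home header and the original module docstring (verbatim there). Namespace KEPT: `Summit.HodgeConjecture.HodgeConjecture.Cruxes.HLiu418.F0P6bWDock`;
code bytes = the workfile՚s, docstrings included; preamble (options ∕ `noncomputable section` ∕ `universe u` ∕ `open`s) repeated verbatim from PART 1.
HC_CM is proved only modulo the 7 printed citations (2 remaining: hLiu418 = stmt-HodgeConjecture-24832, h413 = stmt-HodgeConjecture-24833) until rung 0 closes; a re-home is count-neutral. -/

set_option autoImplicit false
set_option linter.dupNamespace false

-- Mathlib's `Over`/`Scheme` APIs are stated across semireducible wrappers (as in the two P6b Lines modules imported here).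
set_option backward.isDefEq.respectTransparency false

noncomputable section

universe u

open CategoryTheory CategoryTheory.Limits AlgebraicGeometry MonoidalCategory CartesianMonoidalCategory
open scoped MonObj
open Literature.AlgebraicGeometry.GroupSchemes Literature.AlgebraicGeometry.GroupSchemes.GroupSchemeKernel
open Literature.AlgebraicGeometry.GroupSchemes.AffineGroupScheme Literature.AlgebraicGeometry.GroupSchemes.TorsionLayer
open Literature.AlgebraicGeometry.Motives Literature.AlgebraicGeometry.Motives.AbelianVariety
open Literature.AlgebraicGeometry.AbelianSchemes Literature.AlgebraicGeometry.AbelianSchemes.AbelianSchemeOver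
open Literature.AlgebraicGeometry.AbelianSchemes.AbelianSchemeOver.DualPair
open Summit.HodgeConjecture.HodgeConjecture.Cruxes.HLiu418.F0P6bWeilCartierDuality
open Literature.AlgebraicGeometry.Motives.AbelianVarietyFrobeniusBlockLagrangian   -- (BLF)՚s ★ namespace (was `…Cruxes.HLiu418.F0P6bFrobeniusLagrangian`)

namespace Summit.HodgeConjecture.HodgeConjecture.Cruxes.HLiu418.F0P6bWDock

/-! ## §4 THE (D-R) SEAM PRE-PAID: the Rosati law base-changes, and the head AFTER a base change to the point

GEN holds the Rosati law UPSTAIRS (`RGDInputsAt.rosati`, over the stage `(𝓜.localise w).total.left`) and reads the dock at a geometric point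
`x̄` after TWO base changes (`ιs`, then `x̄`).  The law `ι(star a) ≫ λ = λ ≫ ι(a)^∨` base-changes along ANY `g : S′ ⟶ S` because the dual
homomorphism does (★ `DualPair.baseChangeHom_dualIsogenyOver_base`, [MumfordFogartyKirwan1994] Ch. 6 §1 Cor. 6.8) and `λ`, `ι` base-change
as `(Over.pullback g).map` (★ `Polarization.baseChange_lam`, ★ `RingAction.baseChange_i`, both `rfl`).  Hop it twice (`g := ιs`, then the head
below with `g := x̄`), or once per hop with `rosati_baseChange`. -/

section BaseChange

variable {S S' : Scheme.{u}} (g : S' ⟶ S) {A₀ : AbelianSchemeOver S} {O : Type} [CommRing O]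

/-- **The Rosati law of a ring action base-changes** along any `g : S′ ⟶ S`: from `ι(star a) ≫ lam = lam ≫ ι(a)^∨` over `S` to the same law for
★ `act₀.baseChange g`, `baseChangeHom lam g` and the base-changed dual pair ★ `D₀.baseChange g` over `S′`.
[cite: MumfordFogartyKirwan1994, Ch. 6 §1 Cor. 6.8 (p. 118)] [cite: Kottwitz1992, §5 (pp. 389–391)] -/
theorem rosati_baseChange (act₀ : A₀.RingAction O) (D₀ : A₀.DualPair) (lam : A₀.X ⟶ D₀.hat.X) (star : O → O)
    (hRos : ∀ a, haveI := act₀.isMonHom_i a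
      act₀.i (star a) ≫ lam = lam ≫ dualIsogenyOver (act₀.i a) D₀ D₀) (a : O) :
    haveI := (act₀.baseChange g).isMonHom_i a
    (act₀.baseChange g).i (star a) ≫ baseChangeHom lam g =
      baseChangeHom lam g ≫ dualIsogenyOver ((act₀.baseChange g).i a) (D₀.baseChange g) (D₀.baseChange g) := by
  haveI := act₀.isMonHom_i a
  have h := congrArg (fun f => (Over.pullback g).map f) (hRos a)
  simp only [Functor.map_comp] at h
  change baseChangeHom (act₀.i (star a)) g ≫ baseChangeHom lam g =
    baseChangeHom lam g ≫ baseChangeHom (A := D₀.hat) (B := D₀.hat) (dualIsogenyOver (act₀.i a) D₀ D₀) g at h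
  rw [DualPair.baseChangeHom_dualIsogenyOver_base g (act₀.i a) D₀ D₀] at h
  exact h

/-- **HEAD AFTER BASE CHANGE `wDockPackage_of_baseChange`** — the package at a `k`-point `x : Spec k ⟶ S` of the base, from the inputs UPSTAIRS
ONLY: `A₀, D₀, pol₀, act₀` over `S` with the Rosati law there (carried down by `rosati_baseChange`; ★ `Polarization.baseChange_lam` is `rfl`) and the
`p`-principality row in (P-1) quasi-inverse currency `pol₀.lam ≫ ν₀ = [d]`, `ν₀` a homomorphism, `p ∤ d` (carried down by `baseChange_lam_comp_eq_mulN`, then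
`eq_one_of_comp_mulN_of_comp_lam`), plus the ring-side (D-ε) `he`; then `wDockPackage_of_line`.  NO point-wise hypothesis remains.  GEN՚s reading at `x̄`
is this head with `S := pullback (𝓜.localise w).total.hom (specResidueField w)`, `A₀ := I.univ.baseChange ιs`, `act₀ := I.act.baseChange ιs`,
`D₀ := I.dual.baseChange ιs`, `pol₀ := I.pol.baseChange ιs`, `hRos₀ := rosati_baseChange ιs I.act I.dual I.pol.lam star (I.rosati-row)`,
`hν₀ := baseChange_lam_comp_eq_mulN I.univ I.dual ιs I.pol d ν (p-principal row)`, `x := x̄.left`.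
[cite: MumfordAV1970, §20 (I) (p. 186) and §23 «The group 𝒢(L)» (pp. 221–234)] [cite: MumfordFogartyKirwan1994, Ch. 6 §1 Cor. 6.8 (p. 118)] [cite: Liu2021, Rem. C.13 (p. 112); Def. C.19 (pp. 116–117)] -/
theorem wDockPackage_of_baseChange {k : Type u} [Field k] [PerfectField k] (p r : ℕ) [Fact p.Prime] [CharP k p]
    (A₀ : AbelianSchemeOver S) (D₀ : A₀.DualPair) (pol₀ : A₀.Polarization D₀)
    (star : O →+* O) (hstar : ∀ a, star (star a) = a) (act₀ : A₀.RingAction O)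
    (hRos₀ : ∀ a, haveI := act₀.isMonHom_i a
      act₀.i (star a) ≫ pol₀.lam = pol₀.lam ≫ dualIsogenyOver (act₀.i a) D₀ D₀)
    {d : ℕ} (hpd : p.Coprime d) (ν₀ : D₀.hat.X ⟶ A₀.X) [IsMonHom ν₀] (hν₀ : pol₀.lam ≫ ν₀ = A₀.mulN d)
    (x : Spec (.of k) ⟶ S) (εu c : O) (he : εu * εu = εu + (p ^ r) • c) :
    WDockPackage k p r (A₀.baseChange x) (D₀.baseChange x) (pol₀.baseChange x) star (act₀.baseChange x) εu :=
  wDockPackage_of_line p r (A₀.baseChange x) (D₀.baseChange x) (pol₀.baseChange x) star hstar (act₀.baseChange x)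
    (fun a => rosati_baseChange x act₀ D₀ pol₀.lam star hRos₀ a)
    (fun _ t hN hl => by
      haveI := isMonHom_baseChangeHom (A := D₀.hat) (B := A₀) ν₀ x
      exact eq_one_of_comp_mulN_of_comp_lam (A₀.baseChange x) (D₀.baseChange x) (pol₀.baseChange x).lam
        (Nat.Coprime.pow_left r hpd) ((Over.pullback x).map ν₀ : (D₀.hat.baseChange x).X ⟶ (A₀.baseChange x).X)
        (baseChange_lam_comp_eq_mulN A₀ D₀ x pol₀ d ν₀ hν₀) t hN hl)
    εu c he

/-- **Variant `wDockPackage_of_baseChange_of_hlam`** — the same with the point-wise clause `hlam` kept raw (for a reader who holds «`λ_x̄` kills no point of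
`A_x̄[p^r]`» in another currency, e.g. (P-2) `eq_one_of_comp_mulN_of_comp_lam_of_kerRank_coprime`). [cite: MumfordAV1970, §20 (I) (p. 186), §23] -/
theorem wDockPackage_of_baseChange_of_hlam {k : Type u} [Field k] [PerfectField k] (p r : ℕ) [Fact p.Prime] [CharP k p]
    (A₀ : AbelianSchemeOver S) (D₀ : A₀.DualPair) (pol₀ : A₀.Polarization D₀)
    (star : O →+* O) (hstar : ∀ a, star (star a) = a) (act₀ : A₀.RingAction O)
    (hRos₀ : ∀ a, haveI := act₀.isMonHom_i a
      act₀.i (star a) ≫ pol₀.lam = pol₀.lam ≫ dualIsogenyOver (act₀.i a) D₀ D₀)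
    (x : Spec (.of k) ⟶ S)
    (hlam : ∀ ⦃T : SchemeOver k⦄ (t : T ⟶ (A₀.baseChange x).X),
      t ≫ (A₀.baseChange x).mulN (p ^ r) = 1 → t ≫ (pol₀.baseChange x).lam = 1 → t = 1)
    (εu c : O) (he : εu * εu = εu + (p ^ r) • c) :
    WDockPackage k p r (A₀.baseChange x) (D₀.baseChange x) (pol₀.baseChange x) star (act₀.baseChange x) εu :=
  wDockPackage_of_line p r (A₀.baseChange x) (D₀.baseChange x) (pol₀.baseChange x) star hstar (act₀.baseChange x)
    (fun a => rosati_baseChange x act₀ D₀ pol₀.lam star hRos₀ a) hlam εu c he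

/-- **Two-step head `wDockPackage_of_baseChange₂`** (ED. 2) — the same package after TWO successive base changes `g : S′ ⟶ S` (at `x̄`: the special
fibre `𝓨_s ↪ 𝓨` of the localised model) and `x : Spec k ⟶ S′` (the geometric point), with EVERY hypothesis stated UPSTAIRS over `S`: the Rosati law
`hRos₀`, the quasi-inverse row `ν₀`, `hν₀ : λ ≫ ν₀ = [d]` with `p ∤ d` (the spine՚s `polQuasiInv`), `star` an involution, `εu` idempotent mod `p ^ r`.
Both seams are paid INSIDE this file: the Rosati base change (`rosati_baseChange`, twice) and the `IsMonHom` instance of the base-changed quasi-inverse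
(★ `isMonHom_baseChangeHom`) — so a consumer՚s glue is ONE `exact` with no instance bookkeeping and no transparency option at the call site.
[cite: MumfordAV1970, §20 (I) (p. 186), §23] [cite: Liu2021, Rem. C.13 (p. 112); Def. C.19 (pp. 116–117)] -/
theorem wDockPackage_of_baseChange₂ {k : Type u} [Field k] [PerfectField k] (p r : ℕ) [Fact p.Prime] [CharP k p]
    (A₀ : AbelianSchemeOver S) (D₀ : A₀.DualPair) (pol₀ : A₀.Polarization D₀)
    (star : O →+* O) (hstar : ∀ a, star (star a) = a) (act₀ : A₀.RingAction O)
    (hRos₀ : ∀ a, haveI := act₀.isMonHom_i a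
      act₀.i (star a) ≫ pol₀.lam = pol₀.lam ≫ dualIsogenyOver (act₀.i a) D₀ D₀)
    {d : ℕ} (hpd : p.Coprime d) (ν₀ : D₀.hat.X ⟶ A₀.X) [IsMonHom ν₀] (hν₀ : pol₀.lam ≫ ν₀ = A₀.mulN d)
    (g₁ : S' ⟶ S) (x : Spec (.of k) ⟶ S') (εu c : O) (he : εu * εu = εu + (p ^ r) • c) :
    WDockPackage k p r ((A₀.baseChange g₁).baseChange x) ((D₀.baseChange g₁).baseChange x) ((pol₀.baseChange g₁).baseChange x) star
      ((act₀.baseChange g₁).baseChange x) εu := by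
  haveI := isMonHom_baseChangeHom (A := D₀.hat) (B := A₀) ν₀ g₁
  exact wDockPackage_of_baseChange p r (A₀.baseChange g₁) (D₀.baseChange g₁) (pol₀.baseChange g₁) star hstar (act₀.baseChange g₁)
    (fun a => rosati_baseChange g₁ act₀ D₀ pol₀.lam star hRos₀ a) hpd
    ((Over.pullback g₁).map ν₀ : (D₀.hat.baseChange g₁).X ⟶ (A₀.baseChange g₁).X)
    (baseChange_lam_comp_eq_mulN A₀ D₀ g₁ pol₀ d ν₀ hν₀) x εu c he

end BaseChange

/-! ## §6.6 (ED. 4, organ (ii)) The socket (E) `t ht t' ht'` FROM ONE INCLUSION + A RANK EQUALITY, and the rank-free POINTS reading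

`WBlockLaw.law_w` ∕ `rL_W'` take (E) as DATA (`t`, `t'` homomorphisms with `t ≫ κ = φ𝒢`, `t' ≫ φ𝒢 = κ`).  The ROOF road computes ONE inclusion and a RANK
(LA3-plan `CENSUS-L3-organs` row (E); A-p03 (g31)'s organ): `heart_of_le_of_finrank_eq` ∕ `heart_of_ge_of_finrank_eq` derive (E) from ONE bare factorisation
through closed immersions + `finrank_k Γ(Φ𝒢) = finrank_k Γ(𝒦)` (★ `isMonHom_of_comp_mono`, ★ `isIso_of_isClosedImmersion_of_finrank_alg_eq`), `heart_of_points`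
from the two-sided points reading; `law_w_of_le` ∕ `law_w_of_ge` ∕ `law_w_of_points` re-export the head in those currencies.  HOME organ of record
`F0/P6/F0P6b-plan/g5/ED4b-heart_of_rank.v2.byimport.F0P6b-plan-g5.lean` 78c42591846f50a9 (by import on ED. 3, rc 0). -/

namespace WBlockLawED4b

variable {k : Type u} [Field k]

/-- **`heart_of_le_of_finrank_eq` — (E) FROM ONE INCLUSION AND A RANK EQUALITY.**  Two closed subgroups `φ𝒢 : Φ𝒢 ↪ 𝒢l`, `κ : 𝒦 ↪ 𝒢l`
(homomorphic closed immersions, `Γ` finite over `k`) with `Φ𝒢 ≤ 𝒦` — a bare factorisation `t ≫ κ = φ𝒢` — and `dim_k Γ(Φ𝒢) = dim_k Γ(𝒦)` are the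
SAME subgroup: `t` is a homomorphism (cancel the mono `κ`) and an isomorphism (a closed immersion of equal finite rank), and `t' := t⁻¹` is a
homomorphism with `t' ≫ φ𝒢 = κ`. [cite: Tate1997FiniteFlatGroupSchemes, §(3.7) p. 145, §(3.8) p. 146] [cite: Waterhouse1979, §14.1 Theorem] -/
theorem heart_of_le_of_finrank_eq
    (𝒢l : SchemeOver k) [GrpObj 𝒢l]
    (Φ𝒢 : SchemeOver k) [GrpObj Φ𝒢] [IsAffine Φ𝒢.left] [Module.Finite k (Alg Φ𝒢)]
    (φ𝒢 : Φ𝒢 ⟶ 𝒢l) [IsMonHom φ𝒢] [IsClosedImmersion φ𝒢.left]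
    (𝒦 : SchemeOver k) [GrpObj 𝒦] [IsAffine 𝒦.left] [Module.Finite k (Alg 𝒦)]
    (κ : 𝒦 ⟶ 𝒢l) [IsMonHom κ] [IsClosedImmersion κ.left]
    (t : Φ𝒢 ⟶ 𝒦) (ht : t ≫ κ = φ𝒢) (hrk : Module.finrank k (Alg Φ𝒢) = Module.finrank k (Alg 𝒦)) :
    IsMonHom t ∧ IsIso t ∧ ∃ t' : 𝒦 ⟶ Φ𝒢, IsMonHom t' ∧ t ≫ t' = 𝟙 Φ𝒢 ∧ t' ≫ t = 𝟙 𝒦 ∧ t' ≫ φ𝒢 = κ := by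
  haveI : Mono κ := Over.mono_of_mono_left _
  haveI : Mono φ𝒢 := Over.mono_of_mono_left _
  haveI : IsMonHom (t ≫ κ) := by rw [ht]; infer_instance
  haveI ht_hom : IsMonHom t := isMonHom_of_comp_mono t κ
  have hleft : t.left ≫ κ.left = φ𝒢.left := by rw [← Over.comp_left, ht]
  haveI : IsClosedImmersion (t.left ≫ κ.left) := by rw [hleft]; infer_instance
  haveI : IsClosedImmersion t.left := IsClosedImmersion.of_comp_isClosedImmersion t.left κ.left
  haveI ht_iso : IsIso t := isIso_of_isClosedImmersion_of_finrank_alg_eq t hrk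
  have ht' : inv t ≫ φ𝒢 = κ := by rw [← ht, IsIso.inv_hom_id_assoc]
  haveI : IsMonHom (inv t ≫ φ𝒢) := by rw [ht']; infer_instance
  haveI : IsMonHom (inv t) := isMonHom_of_comp_mono (inv t) φ𝒢
  exact ⟨ht_hom, ht_iso, inv t, this, IsIso.hom_inv_id t, IsIso.inv_hom_id t, ht'⟩

/-- The same with the inclusion the other way (`𝒦 ≤ Φ𝒢`): symmetric instance of `heart_of_le_of_finrank_eq`.
[cite: Tate1997FiniteFlatGroupSchemes, §(3.7) p. 145, §(3.8) p. 146] -/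
theorem heart_of_ge_of_finrank_eq
    (𝒢l : SchemeOver k) [GrpObj 𝒢l]
    (Φ𝒢 : SchemeOver k) [GrpObj Φ𝒢] [IsAffine Φ𝒢.left] [Module.Finite k (Alg Φ𝒢)]
    (φ𝒢 : Φ𝒢 ⟶ 𝒢l) [IsMonHom φ𝒢] [IsClosedImmersion φ𝒢.left]
    (𝒦 : SchemeOver k) [GrpObj 𝒦] [IsAffine 𝒦.left] [Module.Finite k (Alg 𝒦)]
    (κ : 𝒦 ⟶ 𝒢l) [IsMonHom κ] [IsClosedImmersion κ.left]
    (t' : 𝒦 ⟶ Φ𝒢) (ht' : t' ≫ φ𝒢 = κ) (hrk : Module.finrank k (Alg Φ𝒢) = Module.finrank k (Alg 𝒦)) :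
    IsMonHom t' ∧ IsIso t' ∧ ∃ t : Φ𝒢 ⟶ 𝒦, IsMonHom t ∧ t' ≫ t = 𝟙 𝒦 ∧ t ≫ t' = 𝟙 Φ𝒢 ∧ t ≫ κ = φ𝒢 :=
  heart_of_le_of_finrank_eq 𝒢l 𝒦 κ Φ𝒢 φ𝒢 t' ht' hrk.symm

/-- **`heart_of_points` — (E) FROM THE TWO-SIDED POINTS READING.**  If the closed subgroups `φ𝒢 : Φ𝒢 ↪ 𝒢l` and `κ : 𝒦 ↪ 𝒢l` have the same
`T`-points for every `T` (`y` factors through `φ𝒢` iff it factors through `κ`), then the two factorisations `t ≫ κ = φ𝒢`, `t' ≫ φ𝒢 = κ` exist and are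
homomorphisms (cancel the monos).  No rank, no finiteness. [cite: Tate1997FiniteFlatGroupSchemes, §(3.8) p. 146] -/
theorem heart_of_points
    (𝒢l : SchemeOver k) [GrpObj 𝒢l]
    (Φ𝒢 : SchemeOver k) [GrpObj Φ𝒢] (φ𝒢 : Φ𝒢 ⟶ 𝒢l) [IsMonHom φ𝒢] [IsClosedImmersion φ𝒢.left]
    (𝒦 : SchemeOver k) [GrpObj 𝒦] (κ : 𝒦 ⟶ 𝒢l) [IsMonHom κ] [IsClosedImmersion κ.left]
    (hE : ∀ ⦃T : SchemeOver k⦄ (y : T ⟶ 𝒢l), (∃ c : T ⟶ Φ𝒢, c ≫ φ𝒢 = y) ↔ ∃ c : T ⟶ 𝒦, c ≫ κ = y) :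
    ∃ (t : Φ𝒢 ⟶ 𝒦) (t' : 𝒦 ⟶ Φ𝒢), IsMonHom t ∧ IsMonHom t' ∧ t ≫ κ = φ𝒢 ∧ t' ≫ φ𝒢 = κ := by
  haveI : Mono κ := Over.mono_of_mono_left _
  haveI : Mono φ𝒢 := Over.mono_of_mono_left _
  obtain ⟨t, ht⟩ := (hE φ𝒢).mp ⟨𝟙 Φ𝒢, Category.id_comp _⟩
  obtain ⟨t', ht'⟩ := (hE κ).mpr ⟨𝟙 𝒦, Category.id_comp _⟩
  haveI : IsMonHom (t ≫ κ) := by rw [ht]; infer_instance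
  haveI : IsMonHom (t' ≫ φ𝒢) := by rw [ht']; infer_instance
  exact ⟨t, t', isMonHom_of_comp_mono t κ, isMonHom_of_comp_mono t' φ𝒢, ht, ht'⟩

end WBlockLawED4b

/-! ## The head `law_w` in the (E-rk) currency: one bare factorisation + the rank equality -/
namespace WBlockLawED4b

open Summit.HodgeConjecture.HodgeConjecture.Cruxes.HLiu418.F0P6bWDock.WBlockLaw

variable {k : Type u} [Field k] (p r : ℕ) (A : AbelianSchemeOver (Spec (.of k))) {O : Type} [CommRing O] (star : O →+* O)
  (act : A.RingAction O) (εu : O)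
  (G : SchemeOver k) [GrpObj G] [IsCommMonObj G] (j : G ⟶ A.X) (β : O → (G ⟶ G))
  (W : SchemeOver k) (jW : W ⟶ G)

/-- **`law_w_of_le`** — `WBlockLaw.law_w` with the socket (E) supplied as ONE bare factorisation `t ≫ κ = φ𝒢` (`Φ𝒢 ≤ 𝒦` inside `𝒢l`) through
CLOSED IMMERSIONS plus the rank equality `dim_k Γ(Φ𝒢) = dim_k Γ(𝒦)`; both homomorphism instances and `t'` are derived (`heart_of_le_of_finrank_eq`).
[cite: MumfordAV1970, §20 (I) p. 186, §23 Thm. 2 p. 231] [cite: Tate1997FiniteFlatGroupSchemes, §(3.8) p. 146] [cite: Liu2021, Prop. D.8 (3) pp. 136–138] -/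
theorem law_w_of_le
    (hβj : ∀ a, β a ≫ j = j ≫ act.i a) (hβ1 : β 1 = 𝟙 G) (hβadd : ∀ a b, β (a + b) = β a * β b)
    (hβmul : ∀ a b, β (a * b) = β b ≫ β a) (hq : (𝟙 G) ^ (p ^ r) = 1)
    (hW : ∀ ⦃T : SchemeOver k⦄ (x : T ⟶ G), (∃ s : T ⟶ W, s ≫ jW = x) ↔ x ≫ β (star εu) = x)
    {B : AbelianSchemeOver (Spec (.of k))} (qbar : A.X ⟶ B.X) (𝔠 : Ideal O) (s : O)
    (hqβ : ∀ (b : O) ⦃T : SchemeOver k⦄ (z : T ⟶ G), (z ≫ j) ≫ qbar = 1 → ((z ≫ β b) ≫ j) ≫ qbar = 1)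
    (h𝔠₁ : ∀ a ∈ 𝔠, ∃ b c₁ : O, a * star εu = s * b + (p ^ r : ℕ) * c₁)
    (h𝔠₂ : ∃ a ∈ 𝔠, ∃ b c₂ : O, s * star εu = a * b + (p ^ r : ℕ) * c₂)
    (𝒢l : SchemeOver k) [GrpObj 𝒢l] [IsCommMonObj 𝒢l] [IsAffine 𝒢l.left]
    (Φ𝒢 : SchemeOver k) [GrpObj Φ𝒢] [IsCommMonObj Φ𝒢] [IsAffine Φ𝒢.left] [Module.Free k (Alg Φ𝒢)] [Module.Finite k (Alg Φ𝒢)]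
    (φ𝒢 : Φ𝒢 ⟶ 𝒢l) [IsMonHom φ𝒢] [IsClosedImmersion φ𝒢.left]
    (𝒦 : SchemeOver k) [GrpObj 𝒦] [IsCommMonObj 𝒦] [IsAffine 𝒦.left] [Module.Free k (Alg 𝒦)] [Module.Finite k (Alg 𝒦)]
    (κ : 𝒦 ⟶ 𝒢l) [IsMonHom κ] [IsClosedImmersion κ.left] (eW : W ≅ cartierDual 𝒢l)
    -- (E-rk): ONE inclusion + equal ranks
    (t : Φ𝒢 ⟶ 𝒦) (ht : t ≫ κ = φ𝒢) (hrk : Module.finrank k (Alg Φ𝒢) = Module.finrank k (Alg 𝒦))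
    [PerfectField k] [Fact p.Prime] [CharP k p]
    (hlawW : ∀ ⦃T : SchemeOver k⦄ (x : T ⟶ W),
      (∃ c : T ⟶ annihilator φ𝒢, c ≫ (annihilatorι φ𝒢 ≫ eW.inv) = x) ↔
        ((x ≫ jW) ≫ j) ≫ (A.toAffine.toAbelianVariety.relFrobenius p r).hom.hom.hom = 1)
    (hKW : ∀ ⦃T : SchemeOver k⦄ (x : T ⟶ W),
      (((x ≫ jW) ≫ β s) ≫ j) ≫ qbar = 1 ↔ ∃ c : T ⟶ annihilator κ, c ≫ (annihilatorι κ ≫ eW.inv) = x)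
    [IsClosedImmersion j.left]
    (hG : ∀ ⦃T : SchemeOver k⦄ (t : T ⟶ A.X),
      (∃ s : T ⟶ G, s ≫ j = t) ↔ t ≫ ((((p ^ r : ℕ) : ℤ) • 𝟙 A.toAffine.toAbelianVariety).hom.hom.hom) = 1) :
    ∀ ⦃T : SchemeOver k⦄ (x : T ⟶ A.X), x ≫ A.mulN (p ^ r) = 1 → x ≫ act.i (star εu) = x →
      (x ≫ relFrobeniusOver p r A.X = (1 : T ⟶ (A.baseChange (frobSpec k p r)).X) ↔ ∀ a ∈ 𝔠, x ≫ act.i a ≫ qbar = 1) := by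
  obtain ⟨ht_hom, -, t', ht'_hom, -, -, ht'⟩ := heart_of_le_of_finrank_eq 𝒢l Φ𝒢 φ𝒢 𝒦 κ t ht hrk
  exact law_w p r A star act εu G j β W jW hβj hβ1 hβadd hβmul hq hW qbar 𝔠 s hqβ h𝔠₁ h𝔠₂ 𝒢l Φ𝒢 φ𝒢 𝒦 κ eW t ht t' ht' hlawW hKW hG

/-- **`law_w_of_ge`** — the same with the inclusion `𝒦 ≤ Φ𝒢` (`t' ≫ φ𝒢 = κ`) given instead.
[cite: MumfordAV1970, §20 (I) p. 186, §23 Thm. 2 p. 231] [cite: Tate1997FiniteFlatGroupSchemes, §(3.8) p. 146] [cite: Liu2021, Prop. D.8 (3) pp. 136–138] -/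
theorem law_w_of_ge
    (hβj : ∀ a, β a ≫ j = j ≫ act.i a) (hβ1 : β 1 = 𝟙 G) (hβadd : ∀ a b, β (a + b) = β a * β b)
    (hβmul : ∀ a b, β (a * b) = β b ≫ β a) (hq : (𝟙 G) ^ (p ^ r) = 1)
    (hW : ∀ ⦃T : SchemeOver k⦄ (x : T ⟶ G), (∃ s : T ⟶ W, s ≫ jW = x) ↔ x ≫ β (star εu) = x)
    {B : AbelianSchemeOver (Spec (.of k))} (qbar : A.X ⟶ B.X) (𝔠 : Ideal O) (s : O)
    (hqβ : ∀ (b : O) ⦃T : SchemeOver k⦄ (z : T ⟶ G), (z ≫ j) ≫ qbar = 1 → ((z ≫ β b) ≫ j) ≫ qbar = 1)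
    (h𝔠₁ : ∀ a ∈ 𝔠, ∃ b c₁ : O, a * star εu = s * b + (p ^ r : ℕ) * c₁)
    (h𝔠₂ : ∃ a ∈ 𝔠, ∃ b c₂ : O, s * star εu = a * b + (p ^ r : ℕ) * c₂)
    (𝒢l : SchemeOver k) [GrpObj 𝒢l] [IsCommMonObj 𝒢l] [IsAffine 𝒢l.left]
    (Φ𝒢 : SchemeOver k) [GrpObj Φ𝒢] [IsCommMonObj Φ𝒢] [IsAffine Φ𝒢.left] [Module.Free k (Alg Φ𝒢)] [Module.Finite k (Alg Φ𝒢)]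
    (φ𝒢 : Φ𝒢 ⟶ 𝒢l) [IsMonHom φ𝒢] [IsClosedImmersion φ𝒢.left]
    (𝒦 : SchemeOver k) [GrpObj 𝒦] [IsCommMonObj 𝒦] [IsAffine 𝒦.left] [Module.Free k (Alg 𝒦)] [Module.Finite k (Alg 𝒦)]
    (κ : 𝒦 ⟶ 𝒢l) [IsMonHom κ] [IsClosedImmersion κ.left] (eW : W ≅ cartierDual 𝒢l)
    (t' : 𝒦 ⟶ Φ𝒢) (ht' : t' ≫ φ𝒢 = κ) (hrk : Module.finrank k (Alg Φ𝒢) = Module.finrank k (Alg 𝒦))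
    [PerfectField k] [Fact p.Prime] [CharP k p]
    (hlawW : ∀ ⦃T : SchemeOver k⦄ (x : T ⟶ W),
      (∃ c : T ⟶ annihilator φ𝒢, c ≫ (annihilatorι φ𝒢 ≫ eW.inv) = x) ↔
        ((x ≫ jW) ≫ j) ≫ (A.toAffine.toAbelianVariety.relFrobenius p r).hom.hom.hom = 1)
    (hKW : ∀ ⦃T : SchemeOver k⦄ (x : T ⟶ W),
      (((x ≫ jW) ≫ β s) ≫ j) ≫ qbar = 1 ↔ ∃ c : T ⟶ annihilator κ, c ≫ (annihilatorι κ ≫ eW.inv) = x)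
    [IsClosedImmersion j.left]
    (hG : ∀ ⦃T : SchemeOver k⦄ (t : T ⟶ A.X),
      (∃ s : T ⟶ G, s ≫ j = t) ↔ t ≫ ((((p ^ r : ℕ) : ℤ) • 𝟙 A.toAffine.toAbelianVariety).hom.hom.hom) = 1) :
    ∀ ⦃T : SchemeOver k⦄ (x : T ⟶ A.X), x ≫ A.mulN (p ^ r) = 1 → x ≫ act.i (star εu) = x →
      (x ≫ relFrobeniusOver p r A.X = (1 : T ⟶ (A.baseChange (frobSpec k p r)).X) ↔ ∀ a ∈ 𝔠, x ≫ act.i a ≫ qbar = 1) := by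
  obtain ⟨ht'_hom, -, t, ht_hom, -, -, ht⟩ := heart_of_ge_of_finrank_eq 𝒢l Φ𝒢 φ𝒢 𝒦 κ t' ht' hrk
  exact law_w p r A star act εu G j β W jW hβj hβ1 hβadd hβmul hq hW qbar 𝔠 s hqβ h𝔠₁ h𝔠₂ 𝒢l Φ𝒢 φ𝒢 𝒦 κ eW t ht t' ht' hlawW hKW hG

/-- **`law_w_of_points`** — `WBlockLaw.law_w` with the socket (E) supplied as the two-sided POINTS READING `hE` («`Φ𝒢` and `𝒦` have the same
`T`-points inside `𝒢l`») through closed immersions; `t`, `t'` and both homomorphism instances are derived (`heart_of_points`).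
[cite: MumfordAV1970, §20 (I) p. 186, §23 Thm. 2 p. 231] [cite: Tate1997FiniteFlatGroupSchemes, §(3.8) p. 146] [cite: Liu2021, Prop. D.8 (3) pp. 136–138] -/
theorem law_w_of_points
    (hβj : ∀ a, β a ≫ j = j ≫ act.i a) (hβ1 : β 1 = 𝟙 G) (hβadd : ∀ a b, β (a + b) = β a * β b)
    (hβmul : ∀ a b, β (a * b) = β b ≫ β a) (hq : (𝟙 G) ^ (p ^ r) = 1)
    (hW : ∀ ⦃T : SchemeOver k⦄ (x : T ⟶ G), (∃ s : T ⟶ W, s ≫ jW = x) ↔ x ≫ β (star εu) = x)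
    {B : AbelianSchemeOver (Spec (.of k))} (qbar : A.X ⟶ B.X) (𝔠 : Ideal O) (s : O)
    (hqβ : ∀ (b : O) ⦃T : SchemeOver k⦄ (z : T ⟶ G), (z ≫ j) ≫ qbar = 1 → ((z ≫ β b) ≫ j) ≫ qbar = 1)
    (h𝔠₁ : ∀ a ∈ 𝔠, ∃ b c₁ : O, a * star εu = s * b + (p ^ r : ℕ) * c₁)
    (h𝔠₂ : ∃ a ∈ 𝔠, ∃ b c₂ : O, s * star εu = a * b + (p ^ r : ℕ) * c₂)
    (𝒢l : SchemeOver k) [GrpObj 𝒢l] [IsCommMonObj 𝒢l] [IsAffine 𝒢l.left]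
    (Φ𝒢 : SchemeOver k) [GrpObj Φ𝒢] [IsCommMonObj Φ𝒢] [IsAffine Φ𝒢.left] [Module.Free k (Alg Φ𝒢)] [Module.Finite k (Alg Φ𝒢)]
    (φ𝒢 : Φ𝒢 ⟶ 𝒢l) [IsMonHom φ𝒢] [IsClosedImmersion φ𝒢.left]
    (𝒦 : SchemeOver k) [GrpObj 𝒦] [IsCommMonObj 𝒦] [IsAffine 𝒦.left] [Module.Free k (Alg 𝒦)] [Module.Finite k (Alg 𝒦)]
    (κ : 𝒦 ⟶ 𝒢l) [IsMonHom κ] [IsClosedImmersion κ.left] (eW : W ≅ cartierDual 𝒢l)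
    -- (E-pts): the same `T`-points
    (hE : ∀ ⦃T : SchemeOver k⦄ (y : T ⟶ 𝒢l), (∃ c : T ⟶ Φ𝒢, c ≫ φ𝒢 = y) ↔ ∃ c : T ⟶ 𝒦, c ≫ κ = y)
    [PerfectField k] [Fact p.Prime] [CharP k p]
    (hlawW : ∀ ⦃T : SchemeOver k⦄ (x : T ⟶ W),
      (∃ c : T ⟶ annihilator φ𝒢, c ≫ (annihilatorι φ𝒢 ≫ eW.inv) = x) ↔
        ((x ≫ jW) ≫ j) ≫ (A.toAffine.toAbelianVariety.relFrobenius p r).hom.hom.hom = 1)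
    (hKW : ∀ ⦃T : SchemeOver k⦄ (x : T ⟶ W),
      (((x ≫ jW) ≫ β s) ≫ j) ≫ qbar = 1 ↔ ∃ c : T ⟶ annihilator κ, c ≫ (annihilatorι κ ≫ eW.inv) = x)
    [IsClosedImmersion j.left]
    (hG : ∀ ⦃T : SchemeOver k⦄ (t : T ⟶ A.X),
      (∃ s : T ⟶ G, s ≫ j = t) ↔ t ≫ ((((p ^ r : ℕ) : ℤ) • 𝟙 A.toAffine.toAbelianVariety).hom.hom.hom) = 1) :
    ∀ ⦃T : SchemeOver k⦄ (x : T ⟶ A.X), x ≫ A.mulN (p ^ r) = 1 → x ≫ act.i (star εu) = x →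
      (x ≫ relFrobeniusOver p r A.X = (1 : T ⟶ (A.baseChange (frobSpec k p r)).X) ↔ ∀ a ∈ 𝔠, x ≫ act.i a ≫ qbar = 1) := by
  obtain ⟨t, t', ht_hom, ht'_hom, ht, ht'⟩ := heart_of_points 𝒢l Φ𝒢 φ𝒢 𝒦 κ hE
  exact law_w p r A star act εu G j β W jW hβj hβ1 hβadd hβmul hq hW qbar 𝔠 s hqβ h𝔠₁ h𝔠₂ 𝒢l Φ𝒢 φ𝒢 𝒦 κ eW t ht t' ht' hlawW hKW hG

end WBlockLawED4b

/-! ## §6.7 (ED. 4, organ (iii)) The socket (KW) `hKW` of `WBlockLaw.rL_W'` FROM ISOTROPY (I-iso) + COMPLEMENTARY RANK (I-rk)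

(I-iso) «`β(s)x` killed by `j ≫ q̄` ⇒ the character `e₀(x)` is trivial on `𝒦 ↪ 𝒢l ↪ G`» is PAID on the ROOF road for all `T` («L3» LA3-p03 (g3) `hiso_e₀` over
★ `PolarisedIsogenyKernelShiftedIsotropic` — naturality of the family at `f := q̄`, the descent row `q̄ ≫ λ_B̄ ≫ q̄^∨ = λ ≫ [p]`, fppf `p`-division) and, on
finite points, by the W-line ED. 4 dictionary `comp_e₀_comp_cartierDualMap_eq_one_of_weilChar` + ★ `DualPair.weilChar_comp_lam_eq_one_of_mulN_comp_eq_one`;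
(I-rk) «`rk Γ(W) = rk Γ(Ψ) · rk Γ(𝒦)`» for the shifted kernel `ψ : Ψ ↪ W` is the ROOF road's count.  `hKW_of_isotropy_of_finrank` turns the two into `hKW`
(both directions) by ★ ANNIHILATOR BY RANK (points form) `exists_comp_annihilatorι_comp_inv_iff_of_fac_of_finrank_mul`, the isotropy factorisation being
derived at the universal point `ψ` via `WBlockLaw.exists_annihilator_iff_of_dock`; `finrank_alg_W_eq` lets the count run on `𝒢l`.  HOME organ of record
`F0/P6/F0P6b-plan/g5/ED4c-hKW_of_isotropy.v1.byimport.F0P6b-plan-g5.lean` 2f3ac7e8cadf0c6f (by import on ED. 3, rc 0). -/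

namespace WBlockLawED4c

variable {k : Type u} [Field k] (A : AbelianSchemeOver (Spec (.of k))) {O : Type}
  (G : SchemeOver k) [GrpObj G] [IsCommMonObj G] [IsAffine G.left] [Module.Free k (Alg G)] [Module.Finite k (Alg G)]
  (j : G ⟶ A.X) (β : O → (G ⟶ G))
  (W : SchemeOver k) (jW : W ⟶ G)

/-- **`rk Γ(W) = rk Γ(𝒢l)` through the block duality `eW : W ≅ 𝒢l^D`** (★ `finrank_alg_eq_of_iso`, ★ `finrank_alg_cartierDual`) — so the consumer may
count (I-rk) against `𝒢l` (the `c•w`-layer) instead of `W`. [cite: Tate1997FiniteFlatGroupSchemes, §(3.8) p. 145] -/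
theorem finrank_alg_W_eq (𝒢l : SchemeOver k) [GrpObj 𝒢l] [IsCommMonObj 𝒢l] [IsAffine 𝒢l.left] [Module.Free k (Alg 𝒢l)] [Module.Finite k (Alg 𝒢l)]
    (eW : W ≅ cartierDual 𝒢l) : Module.finrank k (Alg W) = Module.finrank k (Alg 𝒢l) := by
  rw [finrank_alg_eq_of_iso eW, finrank_alg_cartierDual]

/-- **`hKW_of_isotropy_of_finrank` — THE (KW) SOCKET FROM (I-iso) + (I-rk).**  Through the docking law (iv) at a duality `e` of `G` (the package's
`e₀`): if on `W`-points «`β(s)x` killed by `j ≫ q̄`» implies «`e(x)` kills `𝒦`» (isotropy), and the shifted kernel `ψ : Ψ ↪ W` — the closed subscheme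
whose `T`-points are exactly those `x` — has complementary rank `rk Γ(W) = rk Γ(Ψ) · rk Γ(𝒦)`, then «`β(s)x` killed by `j ≫ q̄`» ↔ «`x ∈ ann_{eW}(𝒦)`»,
the head's binder `hKW` token for token.
[cite: MumfordAV1970, §20 (I) p. 186, §23 (4) p. 228, Thm. 2 p. 231] [cite: Tate1997FiniteFlatGroupSchemes, §(3.8) p. 146] [cite: Oda1969, Cor. 1.3] -/
theorem hKW_of_isotropy_of_finrank
    (𝒢l : SchemeOver k) [GrpObj 𝒢l] [IsCommMonObj 𝒢l] [IsAffine 𝒢l.left] [Module.Free k (Alg 𝒢l)] [Module.Finite k (Alg 𝒢l)]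
    (j𝒢 : 𝒢l ⟶ G) [IsMonHom j𝒢]
    (𝒦 : SchemeOver k) [GrpObj 𝒦] [IsCommMonObj 𝒦] [IsAffine 𝒦.left] [Module.Free k (Alg 𝒦)] [Module.Finite k (Alg 𝒦)]
    (κ : 𝒦 ⟶ 𝒢l) [IsMonHom κ] [IsClosedImmersion κ.left] (eW : W ≅ cartierDual 𝒢l)
    -- the docking law (iv) at a duality `e` of `G` (the W-line՚s `e₀`)
    (e : G ⟶ cartierDual G) (hdock : jW ≫ e ≫ cartierDualMap j𝒢 = eW.hom)
    {B : AbelianSchemeOver (Spec (.of k))} (qbar : A.X ⟶ B.X) (s : O)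
    -- (I-iso): «β(s)x killed by j ≫ q̄ ⇒ the character e(x) is trivial on 𝒦»
    (hiso : ∀ ⦃T : SchemeOver k⦄ (x : T ⟶ W), (((x ≫ jW) ≫ β s) ≫ j) ≫ qbar = 1 → ((x ≫ jW) ≫ e) ≫ cartierDualMap (κ ≫ j𝒢) = 1)
    -- (I-rk): the shifted kernel as a closed subscheme with its points law, of complementary rank
    (Ψ : SchemeOver k) [GrpObj Ψ] [IsAffine Ψ.left] [Module.Finite k (Alg Ψ)] (ψ : Ψ ⟶ W) [IsClosedImmersion ψ.left]
    (hΨ : ∀ ⦃T : SchemeOver k⦄ (x : T ⟶ W), (∃ c : T ⟶ Ψ, c ≫ ψ = x) ↔ (((x ≫ jW) ≫ β s) ≫ j) ≫ qbar = 1)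
    (hrk : Module.finrank k (Alg W) = Module.finrank k (Alg Ψ) * Module.finrank k (Alg 𝒦))
    ⦃T : SchemeOver k⦄ (x : T ⟶ W) :
    (((x ≫ jW) ≫ β s) ≫ j) ≫ qbar = 1 ↔ ∃ c : T ⟶ annihilator κ, c ≫ (annihilatorι κ ≫ eW.inv) = x := by
  -- the universal point of `Ψ` is killed, hence (isotropy + dock) factors through the annihilator
  have hψ : (((ψ ≫ jW) ≫ β s) ≫ j) ≫ qbar = 1 := (hΨ ψ).mp ⟨𝟙 Ψ, Category.id_comp _⟩
  obtain ⟨i, hi⟩ := (WBlockLaw.exists_annihilator_iff_of_dock G W jW 𝒢l j𝒢 𝒦 κ eW e hdock ψ).mpr (hiso ψ hψ)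
  rw [← hΨ x]
  exact (exists_comp_annihilatorι_comp_inv_iff_of_fac_of_finrank_mul κ eW ψ i hi hrk x).symm

/-- **`hKW_of_isotropy_of_finrank'`** — the same with the rank counted against the `c•w`-layer: `rk Γ(𝒢l) = rk Γ(Ψ) · rk Γ(𝒦)`.
[cite: Tate1997FiniteFlatGroupSchemes, §(3.8) pp. 145–146] [cite: MumfordAV1970, §23 Thm. 2 p. 231] -/
theorem hKW_of_isotropy_of_finrank'
    (𝒢l : SchemeOver k) [GrpObj 𝒢l] [IsCommMonObj 𝒢l] [IsAffine 𝒢l.left] [Module.Free k (Alg 𝒢l)] [Module.Finite k (Alg 𝒢l)]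
    (j𝒢 : 𝒢l ⟶ G) [IsMonHom j𝒢]
    (𝒦 : SchemeOver k) [GrpObj 𝒦] [IsCommMonObj 𝒦] [IsAffine 𝒦.left] [Module.Free k (Alg 𝒦)] [Module.Finite k (Alg 𝒦)]
    (κ : 𝒦 ⟶ 𝒢l) [IsMonHom κ] [IsClosedImmersion κ.left] (eW : W ≅ cartierDual 𝒢l)
    (e : G ⟶ cartierDual G) (hdock : jW ≫ e ≫ cartierDualMap j𝒢 = eW.hom)
    {B : AbelianSchemeOver (Spec (.of k))} (qbar : A.X ⟶ B.X) (s : O)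
    (hiso : ∀ ⦃T : SchemeOver k⦄ (x : T ⟶ W), (((x ≫ jW) ≫ β s) ≫ j) ≫ qbar = 1 → ((x ≫ jW) ≫ e) ≫ cartierDualMap (κ ≫ j𝒢) = 1)
    (Ψ : SchemeOver k) [GrpObj Ψ] [IsAffine Ψ.left] [Module.Finite k (Alg Ψ)] (ψ : Ψ ⟶ W) [IsClosedImmersion ψ.left]
    (hΨ : ∀ ⦃T : SchemeOver k⦄ (x : T ⟶ W), (∃ c : T ⟶ Ψ, c ≫ ψ = x) ↔ (((x ≫ jW) ≫ β s) ≫ j) ≫ qbar = 1)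
    (hrk : Module.finrank k (Alg 𝒢l) = Module.finrank k (Alg Ψ) * Module.finrank k (Alg 𝒦))
    ⦃T : SchemeOver k⦄ (x : T ⟶ W) :
    (((x ≫ jW) ≫ β s) ≫ j) ≫ qbar = 1 ↔ ∃ c : T ⟶ annihilator κ, c ≫ (annihilatorι κ ≫ eW.inv) = x :=
  hKW_of_isotropy_of_finrank A G j β W jW 𝒢l j𝒢 𝒦 κ eW e hdock qbar s hiso Ψ ψ hΨ
    ((finrank_alg_W_eq W 𝒢l eW).trans hrk) x

end WBlockLawED4c

end Summit.HodgeConjecture.HodgeConjecture.Cruxes.HLiu418.F0P6bWDock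

end
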